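import Literature.AlgebraicGeometry.Frobenioids.ArchimedeanProp35iiiCounterexample
import HarnessLib

/-!
# Frobenioids II, Proposition 3.5 (i) for `H = N` and `H = A`: COUNTEREXAMPLES over the base
# `D := D₀` with the Galois-collapsing functor (refutation of the typed instances `ArchFrd.Prop35i_N`,
# `ArchFrd.Prop35i_A` AS TYPED — the `N`/`A` twins of finding P35i-F1)

Mochizuki, *The geometry of Frobenioids II: poly-Frobenioids*, Kyushu J. Math. **62** (2008) 401–460,
§3, Proposition 3.5 (i), kurims p. 34 [cite: MochizukiFrdII2008, Prop 3.5 (i) p.34]: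
"Let `A ∈ Ob(H)`; suppose that `B_D → A_D := Base(A)` is a mono-minimal categorical quotient of `B_D` by a
group `G_D ⊆ Aut_D(B_D)` in `D`. Then there exists a pull-back morphism `B → A` that lifts `B_D → A_D`
and a group `G ⊆ Aut_H(B)` that maps isomorphically to `G_D` such that `B → A` is a mono-minimal
categorical quotient of `B` by `G` in `H`" — `H` one of `C, A, N, R` (Ex. 3.3), `D` ANY connected totally
epimorphic category with a functor `D → D₀`, of RC-iso-subanchor type.

STATUS OF THE FOUR TYPED INSTANCES (abc-iut-L1-t9, `ArchimedeanTheoremsInstances.lean`; FACT-LIST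
F-0857/F-0858/F-0859/F-0860). `Prop35i_C` is FALSE as typed (`ArchFrd.not_prop35i_C_collapse`,
abc-iut-w4-d100 gen 0, p413286); `Prop35i_R` is TRUE as typed (`ArchFrd.Prop35i_R_holds`,
`ArchimedeanQuotientLiftingRigidAsTyped.lean`); the REPAIRED forms (Galois saturation of the quotient
datum) hold for all four (`Prop35iR_{C,A,N,R}_holds`). This file settles the remaining two AS TYPED:
* **`not_prop35i_N_collapse : ¬ Prop35i_N D0.collapse`** — the non-rigidified angloid `N = A^lin`;
* **`not_prop35i_A_collapse : ¬ Prop35i_A D0.collapse`** — the angular Frobenioid `A` with its own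
  structure over the zero divisor monoid;
with packaged existence statements `exists_base_not_prop35i_N`, `exists_base_not_prop35i_A`.
MECHANISM (as for `C`, and as in abc-iut-w4-d027's P35iii-F1 `not_prop35iii_N_collapse`): over the
Galois-collapsing functor `π : D₀ → D₀` (identity on objects, `conj ↦ id`), take `A :=` the real unit
object, `B_D := Spec ℂ`, `G_D := Gal(ℂ/ℝ)`, `B_D → A_D := (Spec ℂ → Spec ℝ)` (a mono-minimal categorical
quotient in `D₀`). For ANY lift `(B, f, Γ)` as in the conclusion, `B` is complex, every `γ ∈ Γ` has
`C₀`-component over the identity (the image of `Γ` in `D₀` is killed by `π`), so the phase-twisted arrow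
`ψ := ((Base f₀, deg f₀, i · c_{f₀}), f_D)` — an arrow of `N` resp. `A`, since `|i| = 1` makes it an
isometry exactly when `f` is and it has the degree of `f` — is `Γ`-invariant exactly as `f` is; a
factorisation `ψ = f ≫ ψ'` forces an endomorphism of the REAL object `A` with scalar `i ∉ ℝ^×`. So `f` is
not even a categorical quotient in `N` resp. `A`. (For `R` the rigidification excludes the phase twist
and the item holds.) WHERE PRINT SLIPS: p. 34 "it follows again from the simple, explicit structure of
`H₀` …" needs an element of `G_D` over complex conjugation when `B_D` is complex over a real `A_D`
(GAP-LEDGER G-w4d100-1; repaired statement `Prop35iR`). FINDING about one printed item; no side is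
taken on [IUTchIII] Cor. 3.12; typed ≠ proved except where a `theorem` says so.
-/

namespace Literature.AlgebraicGeometry.Frobenioids

open CategoryTheory
open scoped Pointwise

noncomputable section

namespace ArchFrd

universe v u

section General

variable {D : Type u} [Category.{v} D] (π : D ⥤ D0)

/-- Composition in `A ⊆ C` is composition in `C` on underlying arrows (wide subcategory).
[cite: MochizukiFrdII2008, Ex 3.3 (iii) p.28] -/
theorem A.hom_comp_hom {X Y Z : A π} (g : X ⟶ Y) (h : Y ⟶ Z) : (g ≫ h).hom = g.hom ≫ h.hom := rfl

/-- Two arrows of `A` with the same underlying `C`-arrow are equal. [cite: MochizukiFrdII2008, Ex 3.3 (iii) p.28] -/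
theorem A.hom_ext' {X Y : A π} {g h : X ⟶ Y} (e : g.hom = h.hom) : g = h :=
  WideSubcategory.hom_ext _ e

end General

/-! ### The phase twist of an arrow of `C` into the real unit object over the collapsing base -/

section Twist

variable {B : C D0.collapse}

/-- Over the collapsing functor, an endomorphism of an object of `C` has `C₀`-component over the identity
of `D₀` (the compatibility square, `π` killing `Aut`). [cite: MochizukiFrdII2008, Ex 3.3 (i) p.28] -/
theorem base_fst_eq_id_of_endo {X : C D0.collapse} (γ : X ⟶ X) : C0.Base γ.fst = 𝟙 _ := by
  have w := γ.w
  rw [D0.collapse_map_endo, Category.comp_id] at w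
  exact (cancel_mono X.iso.hom).1 (w.trans (Category.id_comp _).symm)

/-- **The phase twist.** For an arrow `f = (f₀, f_D)` of `C = C₀ ×_{D₀} D₀` (collapsing base) from a
COMPLEX object `B` to the real unit object there is an arrow `ψ := ((Base f₀, deg f₀, i · c_{f₀}), f_D)`
(the region of the target is isotropic and `|i| = 1`) which (a) is an isometry of `C` when `f` is, with
the same Frobenius degree as `f`; (b) is fixed by every endomorphism `γ` of `B` fixing `f` whose
`C₀`-component lies over the identity of `D₀`; (c) does NOT factor through `f` — the factor would be an
endomorphism of the REAL unit object with scalar `i ∉ ℝ^×`. [cite: MochizukiFrdII2008, Prop 3.5 (i) p.34] -/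
theorem exists_phaseTwist (hBc : B.fst.base = D0.complex) (fC : B ⟶ unitObjOver D0.collapse D0.real) :
    ∃ ψ : B ⟶ unitObjOver D0.collapse D0.real,
      (PreFrobenioid.isometricMorphisms (C.toElem D0.collapse) fC →
          PreFrobenioid.isometricMorphisms (C.toElem D0.collapse) ψ) ∧
        C0.degFr ψ.fst = C0.degFr fC.fst ∧
        (∀ γ : B ⟶ B, C0.Base γ.fst = 𝟙 _ → γ ≫ fC = fC → γ ≫ ψ = ψ) ∧
        ∀ ψ' : unitObjOver D0.collapse D0.real ⟶ unitObjOver D0.collapse D0.real, fC ≫ ψ' ≠ ψ := by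
  have hiso : (unitObjOver D0.collapse D0.real).fst.region.IsIsotropic :=
    AngularRegion.isIsotropic_isotropicOfTip 1
  -- the `C₀`-arrow `(Base f₀, deg f₀, i · c_{f₀})`
  let ψ₀ : B.fst ⟶ (unitObjOver D0.collapse D0.real).fst :=
    { base := C0.Base fC.fst
      degFr := C0.degFr fC.fst
      scalar := unitI * C0.scalar fC.fst
      scalar_mem := by
        rw [hBc, D0.scalars_complex]
        exact Subgroup.mem_top _
      mapsTo := by
        have hf := (fC.fst).mapsTo
        intro x hx
        obtain ⟨y, hy, rfl⟩ := Set.mem_smul_set.mp hx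
        have hy' : C0.scalar fC.fst • y ∈
            C0.pullRegion (unitObjOver D0.collapse D0.real).fst (C0.Base fC.fst) :=
          hf (Set.smul_mem_smul_set hy)
        unfold C0.pullRegion at hy' ⊢
        rw [C0.image_galAct_of_isIsotropic hiso] at hy' ⊢
        rw [C0.mem_carrier_of_isIsotropic hiso] at hy' ⊢
        rw [smul_eq_mul] at hy' ⊢
        rw [mul_assoc, map_mul, absHom_unitI, one_mul]
        exact hy' }
  let ψ : B ⟶ unitObjOver D0.collapse D0.real := ⟨ψ₀, fC.snd, fC.w⟩
  refine ⟨ψ, fun hf => ?_, rfl, fun γ hγb h1 => ?_, fun ψ' hC => ?_⟩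
  · -- (a) same `Div` as `f` (`|i| = 1`)
    have hdiv : C0.div ψ₀ = C0.div fC.fst := by
      have hr : C0.ratio ψ₀ = C0.ratio fC.fst := by
        unfold C0.ratio
        change _ / (‖((unitI * C0.scalar fC.fst : ℂˣ) : ℂ)‖ * _ ^ (C0.degFr fC.fst : ℕ)) =
          _ / (‖(C0.scalar fC.fst : ℂ)‖ * _ ^ (C0.degFr fC.fst : ℕ))
        rw [Units.val_mul, norm_mul]
        simp [unitI]
      unfold C0.div
      simp only [hr]
    have e1 : PreFrobenioid.Div C0.toElem ψ.fst = PreFrobenioid.Div C0.toElem fC.fst := hdiv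
    have key : PreFrobenioid.Div (C.toElem D0.collapse) ψ = PreFrobenioid.Div (C.toElem D0.collapse) fC := by
      rw [PreFrobenioid.fiberProduct_div, PreFrobenioid.fiberProduct_div, e1]
    change PreFrobenioid.Div (C.toElem D0.collapse) ψ = 1
    rw [key]
    exact hf
  · -- (b) invariance transfer
    have hfst : γ.fst ≫ fC.fst = fC.fst := congrArg CFP.Hom.fst h1
    have hsnd : γ.snd ≫ fC.snd = fC.snd := congrArg CFP.Hom.snd h1
    have hdeg : C0.degFr γ.fst * C0.degFr fC.fst = C0.degFr fC.fst := by
      have h2 := congrArg C0.degFr hfst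
      rwa [C0.degFr_comp'] at h2
    have hsc : (C0.Base γ.fst).act (C0.scalar fC.fst) * C0.scalar γ.fst ^ (C0.degFr fC.fst : ℕ) =
        C0.scalar fC.fst := by
      have h2 := congrArg C0.scalar hfst
      rwa [C0.scalar_comp'] at h2
    rw [hγb] at hsc
    unfold D0.Hom.act at hsc
    rw [D0.twists_id, D0.galAct_false] at hsc
    refine CFP.hom_ext (C0.hom_ext ?_ ?_ ?_) hsnd
    · change C0.Base γ.fst ≫ C0.Base fC.fst = C0.Base fC.fst
      rw [hγb, Category.id_comp]
    · change C0.degFr γ.fst * C0.degFr fC.fst = C0.degFr fC.fst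
      exact hdeg
    · change (C0.Base γ.fst).act (unitI * C0.scalar fC.fst) * C0.scalar γ.fst ^ (C0.degFr fC.fst : ℕ) =
        unitI * C0.scalar fC.fst
      rw [hγb]
      unfold D0.Hom.act
      rw [D0.twists_id, D0.galAct_false, mul_assoc, hsc]
  · -- (c) non-factorisation
    have hfst : fC.fst ≫ ψ'.fst = ψ₀ := congrArg CFP.Hom.fst hC
    have hd1 : C0.degFr ψ'.fst = 1 := by
      have h2 := congrArg C0.degFr hfst
      rw [C0.degFr_comp'] at h2
      change C0.degFr fC.fst * C0.degFr ψ'.fst = C0.degFr fC.fst at h2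
      exact mul_left_cancel (h2.trans (mul_one _).symm)
    have hs : C0.scalar ψ'.fst = unitI := by
      have h2 := congrArg C0.scalar hfst
      rw [C0.scalar_comp', hd1, PNat.one_coe, pow_one] at h2
      change (C0.Base fC.fst).act (C0.scalar ψ'.fst) * C0.scalar fC.fst = unitI * C0.scalar fC.fst at h2
      have hbt : D0.Hom.twists (C0.Base fC.fst) = false := D0.twists_of_real _
      unfold D0.Hom.act at h2
      rw [hbt, D0.galAct_false] at h2
      exact mul_right_cancel h2
    have hmem : C0.scalar ψ'.fst ∈ D0.scalars D0.real := ψ'.fst.scalar_mem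
    rw [hs] at hmem
    exact unitI_not_mem_scalars_real hmem

end Twist

/-! ### The refutation for `N = A^lin` -/

/-- **Proposition 3.5 (i) fails AS TYPED for the non-rigidified angloid `N` over `C₀ ×_{D₀} D₀` with the
Galois-collapsing functor** (FACT-LIST F-0859 `Prop35i_N`; see the module docstring).
[cite: MochizukiFrdII2008, Prop 3.5 (i) p.34] -/
theorem not_prop35i_N_collapse :
    ¬ Literature.AlgebraicGeometry.Frobenioids.ArchFrd.Prop35i_N D0.collapse := by
  intro h
  obtain ⟨B, f, e, Γ, φ, -, -, -, hquot⟩ :=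
    h D0.isOfRCIsoSubanchorType_collapse (⟨⟨unitObjOver D0.collapse D0.real⟩⟩ : N D0.collapse)
      D0.complex D0.toRealHom ⊤ D0.isMonoMinimalQuotient_top_toRealHom
  obtain ⟨⟨hinv, huniq⟩, -⟩ := hquot
  -- `B` lies over `Spec ℂ`: its `C₀`-component is a complex object
  have hBc : B.obj.obj.fst.base = D0.complex := D0.eq_complex_of_hom_complex (B.obj.obj.iso.hom ≫ e.hom)
  -- the phase twist of `f`, an arrow of `N` (a linear isometry, as `f` is)
  set fC := f.hom.hom with hfC
  obtain ⟨ψC, hψisoC, hdegC, hinvC, hfacC⟩ := exists_phaseTwist hBc fC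
  have hψiso : PreFrobenioid.isometricMorphisms (C.toElem D0.collapse) ψC := hψisoC f.hom.property
  have hψlin : PreFrobenioid.linearMorphisms (A.toElem D0.collapse)
      (⟨ψC, hψiso⟩ : B.obj ⟶ (⟨unitObjOver D0.collapse D0.real⟩ : A D0.collapse)) := by
    have hl : C0.degFr fC.fst = 1 := f.property
    change C0.degFr ψC.fst = 1
    rw [hdegC, hl]
  let ψ : B ⟶ (⟨⟨unitObjOver D0.collapse D0.real⟩⟩ : N D0.collapse) := ⟨⟨ψC, hψiso⟩, hψlin⟩
  -- `ψ` is `Γ`-invariant, exactly as `f` is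
  have hψ : ∀ γ ∈ Γ, γ.hom ≫ ψ = ψ := by
    intro γ hγ
    have h1 : γ.hom.hom.hom ≫ fC = fC := by
      rw [hfC, ← N.hom_hom_comp, hinv γ hγ]
    exact N.hom_ext' D0.collapse (hinvC γ.hom.hom.hom (base_fst_eq_id_of_endo γ.hom.hom.hom) h1)
  -- but `ψ` does not factor through `f`
  obtain ⟨ψ', hψ', -⟩ := huniq ψ hψ
  have hC : fC ≫ ψ'.hom.hom = ψC := by
    rw [hfC, ← N.hom_hom_comp, hψ']
  exact hfacC ψ'.hom.hom hC

/-- **Finding P35i-F1 for `N`, packaged**: there is a connected, totally epimorphic base `D → D₀` of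
RC-iso-subanchor type for which the instance `Prop35i_N` of [FrdII] Prop. 3.5 (i) fails.
[cite: MochizukiFrdII2008, Prop 3.5 (i) p.34] -/
theorem exists_base_not_prop35i_N :
    ∃ π : D0 ⥤ D0, IsGraphConnected D0 ∧ IsTotallyEpimorphic D0 ∧
      RC.IsOfRCIsoSubanchorType (baseRC π) ∧
        ¬ Literature.AlgebraicGeometry.Frobenioids.ArchFrd.Prop35i_N π :=
  ⟨D0.collapse, D0.isGraphConnected, D0.isTotallyEpimorphic, D0.isOfRCIsoSubanchorType_collapse,
    not_prop35i_N_collapse⟩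

/-! ### The refutation for the angular Frobenioid `A` -/

/-- **Proposition 3.5 (i) fails AS TYPED for the angular Frobenioid `A` (with its own pre-Frobenioid
structure over the zero divisor monoid) over `C₀ ×_{D₀} D₀` with the Galois-collapsing functor**
(FACT-LIST F-0857 `Prop35i_A`; see the module docstring). [cite: MochizukiFrdII2008, Prop 3.5 (i) p.34] -/
theorem not_prop35i_A_collapse :
    ¬ Literature.AlgebraicGeometry.Frobenioids.ArchFrd.Prop35i_A D0.collapse := by
  intro h
  obtain ⟨B, f, e, Γ, φ, -, -, -, hquot⟩ :=
    h D0.isOfRCIsoSubanchorType_collapse (⟨unitObjOver D0.collapse D0.real⟩ : A D0.collapse)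
      D0.complex D0.toRealHom ⊤ D0.isMonoMinimalQuotient_top_toRealHom
  obtain ⟨⟨hinv, huniq⟩, -⟩ := hquot
  -- `B` lies over `Spec ℂ`: its `C₀`-component is a complex object
  have hBc : B.obj.fst.base = D0.complex := D0.eq_complex_of_hom_complex (B.obj.iso.hom ≫ e.hom)
  -- the phase twist of `f`, an arrow of `A` (an isometry, as `f` is)
  set fC := f.hom with hfC
  obtain ⟨ψC, hψisoC, -, hinvC, hfacC⟩ := exists_phaseTwist hBc fC
  have hψiso : PreFrobenioid.isometricMorphisms (C.toElem D0.collapse) ψC := hψisoC f.property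
  let ψ : B ⟶ (⟨unitObjOver D0.collapse D0.real⟩ : A D0.collapse) := ⟨ψC, hψiso⟩
  -- `ψ` is `Γ`-invariant, exactly as `f` is
  have hψ : ∀ γ ∈ Γ, γ.hom ≫ ψ = ψ := by
    intro γ hγ
    have h1 : γ.hom.hom ≫ fC = fC := by
      rw [hfC, ← A.hom_comp_hom, hinv γ hγ]
    exact A.hom_ext' D0.collapse (hinvC γ.hom.hom (base_fst_eq_id_of_endo γ.hom.hom) h1)
  -- but `ψ` does not factor through `f`
  obtain ⟨ψ', hψ', -⟩ := huniq ψ hψ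
  have hC : fC ≫ ψ'.hom = ψC := by
    rw [hfC, ← A.hom_comp_hom, hψ']
  exact hfacC ψ'.hom hC

/-- **Finding P35i-F1 for `A`, packaged**: there is a connected, totally epimorphic base `D → D₀` of
RC-iso-subanchor type for which the instance `Prop35i_A` of [FrdII] Prop. 3.5 (i) fails.
[cite: MochizukiFrdII2008, Prop 3.5 (i) p.34] -/
theorem exists_base_not_prop35i_A :
    ∃ π : D0 ⥤ D0, IsGraphConnected D0 ∧ IsTotallyEpimorphic D0 ∧
      RC.IsOfRCIsoSubanchorType (baseRC π) ∧
        ¬ Literature.AlgebraicGeometry.Frobenioids.ArchFrd.Prop35i_A π :=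
  ⟨D0.collapse, D0.isGraphConnected, D0.isTotallyEpimorphic, D0.isOfRCIsoSubanchorType_collapse,
    not_prop35i_A_collapse⟩

/-- **The census of [FrdII] Prop. 3.5 (i) AS TYPED over the collapsing base, packaged**: `C`, `A`, `N`
all fail there (the `R`-instance holds for every base, `ArchFrd.Prop35i_R_holds`).
[cite: MochizukiFrdII2008, Prop 3.5 (i) p.34] -/
theorem not_prop35i_CAN_collapse :
    ¬ Literature.AlgebraicGeometry.Frobenioids.ArchFrd.Prop35i_C D0.collapse ∧
      ¬ Literature.AlgebraicGeometry.Frobenioids.ArchFrd.Prop35i_A D0.collapse ∧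
        ¬ Literature.AlgebraicGeometry.Frobenioids.ArchFrd.Prop35i_N D0.collapse :=
  ⟨not_prop35i_C_collapse, not_prop35i_A_collapse, not_prop35i_N_collapse⟩

end ArchFrd

end

end Literature.AlgebraicGeometry.Frobenioids
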